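import Literature.MathematicalPhysics.QuantumFieldTheory.Balaban1983to89.T3CurvGradLog
import HarnessLib

/-!
# `Balaban1983to89.T3SplitLog` — rung R3, crux K1, child «MinimiserStabilityRegPr» (stmt-QuantumFields-19200): the LOWER compositions of the K1aR-pr
# line (divergence clause of the averaged minimiser, averaging action inequality; UPPER in `T3UpperLiftSplitLog`) RE-DERIVED from the log-Lipschitz schema `T3CurvGradLog.MinimiserCurvGradLogAt`
# in place of the `β₀ = 1` schema `MinimiserCurvGradAt` — every window becomes K-dependent and is closed by `exists_gamma_forall_Kmul_θBal_le`; the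
# summable radii pick up a factor `(K + 2)²`

Cell `ym3-torus` (HUMAN RULING D-0037, YM ladder rung R3), seat `ym3-torus-p1` gen 12; cell record HOME/UV3-NODE.md §21 (finding F-g12-1: the `β₀ = 1` reading
of [Balaban1985Variational] (9) fails like `(K − n)·log L` for constrained minimisers; [Balaban1985RegularSpaces] p. 83).  The proofs are the v5 ones
(`T3OneStepAveragingPlaquettes.lowerAlongRegPrMinimisersAt_of_split'`, `T3LowerActionSplit.avgActionIneqAt_of_split`, `T3UpperLiftSplit.regularLiftAlongMinimisersAt_of_split`)
with `B₄ ↦ B₄·((K + 1 − n) + 1)` resp. `B₄·((K − n) + 1)` (both `≤ B₄(K + 2)`): thresholds of the form «`θ ≤ σ`» stay, thresholds through `b` become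
«`(K + 2)θ ≤ σ`», the radii become `r_K = (M L^{3m}/γ)(K + 2)²(√(L⁻¹))^K` (summable).  Hypothesis schemas are never asserted; compositions kernel-checked; `p₀ > 0`.

* §1 `lowerAlongRegPrMinimisersAt_of_splitLog` (LOWER ⇐ Prop 8 ∧ log schema ∧ G-K1a-3a′ → (G-K1a-3b → stub)).
* §2 `avgActionIneqAt_of_splitLog` (G-K1a-3b ⇐ log schema ∧ G-K1a-3b′) and `lowerAlongRegPrMinimisersAt_of_splitLog'''` (LOWER itself).
* (UPPER: `T3UpperLiftSplitLog.regularLiftAlongMinimisersAt_of_splitLog`, `upperAlongRegPrMinimisersAt_of_splitLog'`.)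

References: T. Bałaban, CMP 102 (1985) 277–309 [Balaban1985Variational] (Thm 1 (8)–(10) p.279, Prop 8 p.304); CMP 99 (1985) 75–102 [Balaban1985RegularSpaces]
(Thm 2 (1.36)–(1.39) pp.82–83); J. Federbush, CMP 110 (1987) 293–309 [Federbush1987PhaseCellIII] (Thm 4.3 p.299); C. King, CMP 103 (1986) 323–349 [King1986] ((A.5) p.676).
-/

noncomputable section

open MeasureTheory Filter Topology
open scoped Matrix.Norms.L2Operator
open Literature.MathematicalPhysics.QuantumFieldTheory.Balaban1983to89.T3ContinuumYM3Torus
open Literature.MathematicalPhysics.QuantumFieldTheory.Balaban1983to89.T3UnitLawDensityEML (ℰp measurableE_ℰp)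
open Literature.MathematicalPhysics.QuantumFieldTheory.Balaban1983to89.T3UnitScaleTilt
open Literature.MathematicalPhysics.QuantumFieldTheory.Balaban1983to89.T3TiltDescent
open Literature.MathematicalPhysics.QuantumFieldTheory.Balaban1983to89.T3CruxEstimates
open Literature.MathematicalPhysics.QuantumFieldTheory.Balaban1983to89.T3ConstrainedMinimiser
open Literature.MathematicalPhysics.QuantumFieldTheory.Balaban1983to89.T3DescentFibreTower
open Literature.MathematicalPhysics.QuantumFieldTheory.Balaban1983to89.T3MinimiserStabilityReduction
open Literature.MathematicalPhysics.QuantumFieldTheory.Balaban1983to89.T3RegularMinimiser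
open Literature.MathematicalPhysics.QuantumFieldTheory.Balaban1983to89.T3PrintedRegularMinimiser
open Literature.MathematicalPhysics.QuantumFieldTheory.Balaban1983to89.T3PrintedRegularMinimiserReduction
open Literature.MathematicalPhysics.QuantumFieldTheory.Balaban1983to89.T3PrintedMinimiserExistence
open Literature.MathematicalPhysics.QuantumFieldTheory.Balaban1983to89.T3Thresholds
open Literature.MathematicalPhysics.QuantumFieldTheory.Balaban1983to89.T3LowerAlongMinimisersSplit
open Literature.MathematicalPhysics.QuantumFieldTheory.Balaban1983to89.T3OneStepAveragingPlaquettes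
open Literature.MathematicalPhysics.QuantumFieldTheory.Balaban1983to89.T3AvgDivergenceSplit
open Literature.MathematicalPhysics.QuantumFieldTheory.Balaban1983to89.T3UpperAlongMinimisersSplit
open Literature.MathematicalPhysics.QuantumFieldTheory.Balaban1983to89.T3UpperLiftSplit
open Literature.MathematicalPhysics.QuantumFieldTheory.Balaban1983to89.T3LowerActionSplit
open Literature.MathematicalPhysics.QuantumFieldTheory.Balaban1983to89.T3CurvGradLog
open Literature.MathematicalPhysics.QuantumFieldTheory.Balaban1983to89.B10Eq27TorusAxialLog (toUField unitsField)
open Literature.MathematicalPhysics.QuantumFieldTheory.Balaban1983to89.B10Eq68TorusRegularity (plaqFT covDerivT covDivT)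
open Literature.MathematicalPhysics.QuantumFieldTheory.Balaban1983to89.ExpMeanLog (deltaSU deltaSU_pos)
open Literature.MathematicalPhysics.QuantumFieldTheory.Balaban1983to89.Missing

namespace Literature.MathematicalPhysics.QuantumFieldTheory.Balaban1983to89.T3SplitLog

/-! ## §0 Arithmetic shared by the three compositions -/

section Arithmetic

variable (F : T3Family)

/-- `d − 1 = 2` for the family (bookkeeping). [cite: Balaban1985UV3, (1)-(3) p.256] -/
private theorem d_sub_one_cast (K : ℕ) : (((F.P K).d - 1 : ℕ) : ℝ) = 2 := by
  rw [T3Family.P_d]; norm_num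

/-- The radii with a quadratic prefactor, `r_K = c·(K + 2)²·(√(L⁻¹))^K`, are summable (`L > 1`). [folklore] -/
private theorem summable_sq_mul_sqrt_geometric (c : ℝ) :
    Summable (fun K : ℕ => c * ((K : ℝ) + 2) ^ 2 * (Real.sqrt ((F.L : ℝ)⁻¹)) ^ K) := by
  have hL1 : (1 : ℝ) < F.L := by exact_mod_cast F.hL.2
  set q : ℝ := Real.sqrt ((F.L : ℝ)⁻¹) with hq_def
  have hq0 : 0 ≤ q := Real.sqrt_nonneg _
  have hq1 : q < 1 := (Real.sqrt_lt_sqrt (inv_pos.mpr (L_cast_pos F)).le (inv_lt_one_of_one_lt₀ hL1)).trans_eq Real.sqrt_one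
  have hnorm : ‖q‖ < 1 := by rw [Real.norm_of_nonneg hq0]; exact hq1
  have h2 : Summable (fun K : ℕ => (K : ℝ) ^ 2 * q ^ K) := summable_pow_mul_geometric_of_norm_lt_one 2 hnorm
  have h1 : Summable (fun K : ℕ => (K : ℝ) ^ 1 * q ^ K) := summable_pow_mul_geometric_of_norm_lt_one 1 hnorm
  have h0 : Summable (fun K : ℕ => q ^ K) := summable_geometric_of_lt_one hq0 hq1
  have hsum : Summable (fun K : ℕ => (K : ℝ) ^ 2 * q ^ K + 4 * ((K : ℝ) ^ 1 * q ^ K) + 4 * q ^ K) :=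
    (h2.add (h1.mul_left 4)).add (h0.mul_left 4)
  refine (hsum.mul_left c).congr fun K => ?_
  ring

end Arithmetic

/-! ## §1 LOWER's admissibility composition under the K-dependent window -/

section LowerDiv

/-- **LOWER ⇐ PROP 8 ∧ THE WEAKENED SCHEMA ∧ G-K1a-3a′ → (G-K1a-3b → stub), UNDER THE ROUTE'S PREFIX** — the log-Lipschitz twin of
`T3OneStepAveragingPlaquettes.lowerAlongRegPrMinimisersAt_of_split'` ∘ `T3AvgDivergenceSplit.avgDivSmallAt_of_split`: for `0 < ε₀ ≤ a₀`, `m ≥ 2`,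
`b₀, p₀ > 0`, the `γ₁` of `exists_gamma_forall_Kmul_θBal_le` puts `(K + 2)·θBal(⌊K/m⌋)` below every threshold, in particular below the K-dependent
window `B₃((K − n) + 2)θ ≤ ε₀` (`n = ⌊K/m⌋ ≥ 0`). Normalisation `4C₁B₄ ≤ L³B₃` as in the v5 split. [cite: Balaban1985Variational, Prop 8 p.304 and Thm 1 (9) p.279] -/
theorem lowerAlongRegPrMinimisersAt_of_splitLog {L : ℕ} {a₀ a₁ B₃ B₄ C₁ C₂ c : ℝ} (ha₀ : 0 < a₀) (ha₁ : 0 < a₁) (hB₃ : 0 < B₃)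
    (hB₄ : 0 ≤ B₄) (hC₂ : 0 < C₂) (hc : 0 < c) (h8 : MinimisersIn8At L a₀ a₁ B₃) (hgrad : MinimiserCurvGradLogAt L a₀ a₁ B₃ B₄)
    (havg : AvgCurvGradAt L C₁ C₂ c) (hdom : 4 * (C₁ * B₄) ≤ (L : ℝ) ^ 3 * B₃) :
    ∃ ε₁' : ℝ, 0 < ε₁' ∧ ∀ ε₀ : ℝ, 0 < ε₀ → ε₀ ≤ ε₁' → ∀ m : ℕ, 2 ≤ m → ∀ b₀ p₀ : ℝ, 0 < b₀ → 0 < p₀ →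
      ∃ γ₁ : ℝ, 0 < γ₁ ∧ ∀ (F : T3Family) (γ : ℝ), F.L = L → 0 < γ → γ ≤ γ₁ →
        AvgActionIneqAt F γ b₀ p₀ m ε₀ B₃ → LowerAlongRegPrMinimisersAt F γ b₀ p₀ m ε₀ := by
  refine ⟨a₀, ha₀, fun ε₀ hε₀ hε₀a m hm b₀ p₀ hb hp => ?_⟩
  by_cases hL : 1 < L
  · have hδ2 : 0 < deltaSU (Fin 2) := deltaSU_pos
    have hL0 : (0 : ℝ) < L := by exact_mod_cast (zero_lt_one.trans hL)
    set σ : ℝ := min a₁ (min (c / B₃) (min ((L : ℝ) ^ 3 / (8 * C₂ * B₃)) (min (ε₀ / (151 * B₃))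
      (deltaSU (Fin 2) / (2 * (25 * (L : ℝ) ^ 2 / 4) * B₃))))) with hσ_def
    have hσ : 0 < σ := lt_min ha₁ (lt_min (by positivity) (lt_min (by positivity) (lt_min (by positivity) (by positivity))))
    obtain ⟨γ₁, hγ₁, hγ₁1, hθ⟩ := exists_gamma_forall_Kmul_θBal_le hL hb hp (by omega : 0 < m) hσ
    refine ⟨γ₁, hγ₁, fun F γ hF hγ hγle hineq => ?_⟩
    have hγ1 : γ ≤ 1 := hγle.trans hγ₁1
    obtain ⟨K₀, r, hr, hr0, hineq⟩ := hineq
    refine ⟨max K₀ 1, r, hr, hr0, fun K hK V hV U' hU' hU'min => ?_⟩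
    have hK₀ : K₀ ≤ K := (le_max_left _ _).trans hK
    have hK1 : 1 ≤ K := (le_max_right _ _).trans hK
    have hnK : K / m < K := Nat.div_lt_self (by omega) (by omega)
    have hnK' : K / m < K + 1 := hnK.trans (Nat.lt_succ_self K)
    have hFL : 1 ≤ F.L := F.hL.2.le
    set ε₁ := θBal F.L γ b₀ p₀ (K / m) with hε₁_def
    have hε₁ : 0 < ε₁ := θBal_pos hFL hγ hγ1 hb p₀ (K / m)
    have hKθ : ((K : ℝ) + 2) * ε₁ ≤ σ := by rw [hε₁_def, hF]; exact hθ γ hγ hγle K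
    have hθσ : ε₁ ≤ σ := by rw [hε₁_def, hF]; exact θBal_le_of_Kmul_le hL.le hγ hγ1 hb (hθ γ hγ hγle K)
    have hε₁a : ε₁ ≤ a₁ := hθσ.trans (min_le_left _ _)
    have hε₁c : ε₁ ≤ c / B₃ := hθσ.trans ((min_le_right _ _).trans (min_le_left _ _))
    have hε₁L : ε₁ ≤ (L : ℝ) ^ 3 / (8 * C₂ * B₃) := hθσ.trans ((min_le_right _ _).trans ((min_le_right _ _).trans (min_le_left _ _)))
    have hε₂ : ε₁ ≤ ε₀ / (151 * B₃) :=
      hθσ.trans ((min_le_right _ _).trans ((min_le_right _ _).trans ((min_le_right _ _).trans (min_le_left _ _))))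
    have hε₃ : ε₁ ≤ deltaSU (Fin 2) / (2 * (25 * (L : ℝ) ^ 2 / 4) * B₃) :=
      hθσ.trans ((min_le_right _ _).trans ((min_le_right _ _).trans ((min_le_right _ _).trans (min_le_right _ _))))
    have h151 : 151 * (B₃ * ε₁) ≤ ε₀ := by
      have h := mul_le_mul_of_nonneg_left hε₂ (by positivity : (0 : ℝ) ≤ 151 * B₃)
      rwa [mul_div_cancel₀ _ (by positivity : (151 : ℝ) * B₃ ≠ 0), show 151 * B₃ * ε₁ = 151 * (B₃ * ε₁) by ring] at h
    have hlo : B₃ * ε₁ ≤ ε₀ := by nlinarith [mul_pos hB₃ hε₁]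
    -- the K-dependent window: `B₃((K − n) + 2)ε₁ ≤ B₃(K + 2)ε₁ ≤ 151 B₃ … ` via `(K+2)ε₁ ≤ σ ≤ ε₀/(151 B₃)`
    have hwin : B₃ * (((K - K / m : ℕ) : ℝ) + 2) * ε₁ ≤ ε₀ := by
      have hkK : ((K - K / m : ℕ) : ℝ) + 2 ≤ (K : ℝ) + 2 := by
        have : ((K - K / m : ℕ) : ℝ) ≤ (K : ℝ) := by exact_mod_cast Nat.sub_le K (K / m)
        linarith
      have h1 : (((K - K / m : ℕ) : ℝ) + 2) * ε₁ ≤ σ :=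
        (mul_le_mul_of_nonneg_right hkK hε₁.le).trans hKθ
      have h2 : σ ≤ ε₀ / (151 * B₃) := (min_le_right _ _).trans ((min_le_right _ _).trans ((min_le_right _ _).trans (min_le_left _ _)))
      have h3 : B₃ * (ε₀ / (151 * B₃)) ≤ ε₀ := by
        rw [mul_div_assoc', div_le_iff₀ (by positivity : (0 : ℝ) < 151 * B₃)]
        nlinarith [hε₀]
      calc B₃ * (((K - K / m : ℕ) : ℝ) + 2) * ε₁ = B₃ * ((((K - K / m : ℕ) : ℝ) + 2) * ε₁) := by ring
        _ ≤ B₃ * σ := mul_le_mul_of_nonneg_left h1 hB₃.le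
        _ ≤ B₃ * (ε₀ / (151 * B₃)) := mul_le_mul_of_nonneg_left h2 hB₃.le
        _ ≤ ε₀ := h3
    have hδ : (25 * (F.L : ℝ) ^ 2 / 4) * (B₃ * ε₁) < deltaSU (Fin 2) := by
      rw [hF]
      have hpos : (0 : ℝ) < 2 * (25 * (L : ℝ) ^ 2 / 4) * B₃ := by positivity
      have h := mul_le_mul_of_nonneg_left hε₃ hpos.le
      rw [mul_div_cancel₀ _ hpos.ne'] at h
      have h' : (25 * (L : ℝ) ^ 2 / 4) * (B₃ * ε₁) = (2 * (25 * (L : ℝ) ^ 2 / 4) * B₃ * ε₁) / 2 := by ring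
      rw [h']
      linarith
    have hmin := isMinOn_of_eq_minActionRegPr F hU'min
    have hU'8 : U' ∈ regFibrePr F (K / m) (K + 1) (hnK'.le) (B₃ * ε₁) V :=
      h8 F hF (K / m) (K + 1) hnK' ε₁ ε₀ hε₁ hε₁a hlo hε₀a V hV U' hU' hmin
    refine ⟨descendTo F ℰp K (K + 1) (Nat.le_succ K) U', ?_, hineq K hK₀ V hV U' hU'8 hmin⟩
    exact descendTo_mem_regFibrePr_log hB₃ hB₄ hC₂ hgrad havg hdom hF hnK hε₁ hε₁a hε₁c hε₁L hlo hε₀a hwin h151 hδ hV hU'8 hmin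
  · refine ⟨1, one_pos, fun F γ hF _ _ _ => ?_⟩
    exact absurd (hF ▸ F.hL.2) hL

end LowerDiv

/-! ## §2 LOWER's action inequality from the weakened schema -/

section LowerAction

/-- **G-K1a-3b ⇐ THE WEAKENED SCHEMA ∧ G-K1a-3b′** (PROVED; log twin of `T3LowerActionSplit.avgActionIneqAt_of_split`), at every radius constant
`B₃′ > 0`: for `0 < ε₀ ≤ a₀`, `m ≥ 10`, `b₀, p₀ > 0` there is `γ₁ > 0` with `AvgActionIneqAt F γ b₀ p₀ m ε₀ B₃′` for all `F` with `F.L = L`, `0 < γ ≤ γ₁`;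
`K₀ = 1`, `r_K = (C₂(B₄² + B₃′B₄ + B₃′³)L³L^{3m_F}/γ)·(K + 2)²·(√(L⁻¹))^K` (the gradient input is `b = B₄θ((K+1−⌊K/m⌋)+1)L^{−3(K+1−⌊K/m⌋)}`,
`(K+1−⌊K/m⌋)+1 ≤ K + 2`). [cite: Balaban1985Variational, Thm 1 (8)-(10) p.279; Federbush1987PhaseCellIII, Thm 4.3 (4.5) p.299] -/
theorem avgActionIneqAt_of_splitLog {L : ℕ} {a₀ a₁ B₃ B₄ C₂ c B₃' : ℝ} (ha₁ : 0 < a₁) (hB₃ : 0 < B₃) (hB₄ : 0 < B₄) (hC₂ : 0 ≤ C₂)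
    (hc : 0 < c) (hB₃' : 0 < B₃') (hgrad : MinimiserCurvGradLogAt L a₀ a₁ B₃ B₄) (hdef : AvgActionDefectAt L C₂ c) :
    ∀ ε₀ : ℝ, 0 < ε₀ → ε₀ ≤ a₀ → ∀ m : ℕ, 10 ≤ m → ∀ b₀ p₀ : ℝ, 0 < b₀ → 0 < p₀ →
      ∃ γ₁ : ℝ, 0 < γ₁ ∧ ∀ (F : T3Family) (γ : ℝ), F.L = L → 0 < γ → γ ≤ γ₁ → AvgActionIneqAt F γ b₀ p₀ m ε₀ B₃' := by
  intro ε₀ hε₀ hε₀a m hm b₀ p₀ hb hp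
  by_cases hL : 1 < L
  · -- thresholds at every height, K-linear form
    set σ : ℝ := min 1 (min a₁ (min (ε₀ / B₃) (min (ε₀ / B₃') (min (c / B₃') (c / B₄))))) with hσ_def
    have hσ : 0 < σ := lt_min one_pos (lt_min ha₁ (lt_min (by positivity) (lt_min (by positivity) (lt_min (by positivity) (by positivity)))))
    obtain ⟨γ₁, hγ₁, hγ₁1, hθ⟩ := exists_gamma_forall_Kmul_θBal_le hL hb hp (by omega : 0 < m) hσ
    refine ⟨γ₁, hγ₁, fun F γ hF hγ hγle => ?_⟩
    subst hF
    have hγ1 : γ ≤ 1 := hγle.trans hγ₁1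
    have hFL : 1 ≤ F.L := F.hL.2.le
    have hLF : (0 : ℝ) < F.L := L_cast_pos F
    -- the radii
    set M : ℝ := C₂ * (B₄ ^ 2 + B₃' * B₄ + B₃' ^ 3) * (F.L : ℝ) ^ 3 with hM_def
    have hM : 0 ≤ M := by positivity
    refine ⟨1, fun K => (M * (F.L : ℝ) ^ (3 * F.m) / γ) * ((K : ℝ) + 2) ^ 2 * (Real.sqrt ((F.L : ℝ)⁻¹)) ^ K,
      summable_sq_mul_sqrt_geometric F _, fun K => by positivity, fun K hK V hV U' hU8 hmin => ?_⟩
    have hnK : K / m < K := Nat.div_lt_self (by omega) (by omega)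
    have hnK' : K / m < K + 1 := hnK.trans (Nat.lt_succ_self K)
    -- `θ := θBal(⌊K/m⌋)`, `τ := (K + 2)θ` and their smallness conditions
    set θ := θBal F.L γ b₀ p₀ (K / m) with hθ_def
    have hθ0 : 0 < θ := θBal_pos hFL hγ hγ1 hb p₀ (K / m)
    have hτσ : ((K : ℝ) + 2) * θ ≤ σ := hθ γ hγ hγle K
    have hθσ : θ ≤ σ := θBal_le_of_Kmul_le hFL hγ hγ1 hb hτσ
    have hθ1 : θ ≤ 1 := hθσ.trans (min_le_left _ _)
    have hθa₁ : θ ≤ a₁ := hθσ.trans ((min_le_right _ _).trans (min_le_left _ _))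
    have hθ3 : θ ≤ ε₀ / B₃ := hθσ.trans ((min_le_right _ _).trans ((min_le_right _ _).trans (min_le_left _ _)))
    have hθ4 : θ ≤ ε₀ / B₃' :=
      hθσ.trans ((min_le_right _ _).trans ((min_le_right _ _).trans ((min_le_right _ _).trans (min_le_left _ _))))
    have hθ5 : θ ≤ c / B₃' :=
      hθσ.trans ((min_le_right _ _).trans ((min_le_right _ _).trans ((min_le_right _ _).trans ((min_le_right _ _).trans
        (min_le_left _ _)))))
    have hτ6 : ((K : ℝ) + 2) * θ ≤ c / B₄ :=
      hτσ.trans ((min_le_right _ _).trans ((min_le_right _ _).trans ((min_le_right _ _).trans ((min_le_right _ _).trans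
        (min_le_right _ _)))))
    have hlo : B₃ * θ ≤ ε₀ := by
      have h := mul_le_mul_of_nonneg_left hθ3 hB₃.le
      rwa [mul_div_cancel₀ _ hB₃.ne'] at h
    have hlo' : B₃' * θ ≤ ε₀ := by
      have h := mul_le_mul_of_nonneg_left hθ4 hB₃'.le
      rwa [mul_div_cancel₀ _ hB₃'.ne'] at h
    have hBc : B₃' * θ ≤ c := by
      have h := mul_le_mul_of_nonneg_left hθ5 hB₃'.le
      rwa [mul_div_cancel₀ _ hB₃'.ne'] at h
    have hB4c : B₄ * (((K : ℝ) + 2) * θ) ≤ c := by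
      have h := mul_le_mul_of_nonneg_left hτ6 hB₄.le
      rwa [mul_div_cancel₀ _ hB₄.ne'] at h
    -- the K-dependent gradient constant `B₄K = B₄·((K + 1 − ⌊K/m⌋) + 1) ≤ B₄(K + 2)`
    set kf : ℝ := ((K + 1 - K / m : ℕ) : ℝ) + 1 with hkf_def
    have hkf1 : 1 ≤ kf := by have := Nat.cast_nonneg (α := ℝ) (K + 1 - K / m); rw [hkf_def]; linarith
    have hkf2 : kf ≤ (K : ℝ) + 2 := by
      have : ((K + 1 - K / m : ℕ) : ℝ) ≤ (K : ℝ) + 1 := by exact_mod_cast Nat.sub_le (K + 1) (K / m)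
      rw [hkf_def]; linarith
    set B₄K : ℝ := B₄ * kf with hB₄K_def
    have hB₄K0 : 0 ≤ B₄K := by positivity
    have hB₄K2 : B₄K ≤ B₄ * ((K : ℝ) + 2) := mul_le_mul_of_nonneg_left hkf2 hB₄.le
    -- the two numbers the minimiser contributes at run `K+1`: `a = B₃′θx^{2(k+1)}`, `b = B₄K θ x^{3(k+1)}`
    set x : ℝ := (F.L : ℝ)⁻¹ with hx_def
    have hx : 0 < x := inv_pos.mpr hLF
    have hx1 : x ≤ 1 := inv_le_one_of_one_le₀ (by exact_mod_cast hFL)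
    set a : ℝ := regThreshold F (K / m) (K + 1) (B₃' * θ) with ha_def
    have ha_eq : a = B₃' * θ * x ^ (2 * (K + 1 - K / m)) := rfl
    set b : ℝ := B₄ * θ * (((K + 1 - K / m : ℕ) : ℝ) + 1) * x ^ (3 * (K + 1 - K / m)) with hb_def
    have hb' : b = B₄K * θ * x ^ (3 * (K + 1 - K / m)) := by rw [hb_def, hB₄K_def, hkf_def]; ring
    have ha0 : 0 ≤ a := by rw [ha_eq]; positivity
    have hac : a ≤ c := by rw [ha_eq]; exact (mul_le_of_le_one_right (by positivity) (pow_le_one₀ hx.le hx1)).trans hBc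
    have hb0 : 0 ≤ b := by rw [hb']; positivity
    have hbc : b ≤ c := by
      rw [hb']
      refine (mul_le_of_le_one_right (by positivity) (pow_le_one₀ hx.le hx1)).trans ?_
      calc B₄K * θ ≤ B₄ * ((K : ℝ) + 2) * θ := mul_le_mul_of_nonneg_right hB₄K2 hθ0.le
        _ = B₄ * (((K : ℝ) + 2) * θ) := by ring
        _ ≤ c := hB4c
    -- the weakened (9) for the run-`(K+1)` minimiser, which lies in (6)(ε₀) ⊇ (8)(B₃′θ)
    have hU6 : U' ∈ regFibrePr F (K / m) (K + 1) ((Nat.div_le_self K m).trans (Nat.le_succ K)) ε₀ V := regFibrePr_mono F hlo' V hU8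
    have hder : ∀ (y : Site (F.P (K + 1)) 0) (ν κ κ' : Fin (F.P (K + 1)).d), κ ≠ κ' →
        ‖covDerivT 1 (unitsField (toUField U')) ν (plaqFT (unitsField (toUField U')) κ κ') y‖ ≤ b :=
      fun y ν κ κ' hne => (hgrad F rfl (K / m) (K + 1) hnK' θ ε₀ hθ0 hθa₁ hlo hε₀a V hV U' hU6 hmin y ν κ κ' hne).le
    -- the per-configuration defect
    have hact := hdef F rfl K a b ha0 hac hb0 hbc U' hU8.1.2 hder
    have hβ : 0 ≤ (F.scheme ℰp γ).β K := by
      rw [scheme_β_eq]; exact (inv_pos.mpr (mul_pos hγ (pow_pos hx K))).le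
    have hdef' : C₂ * (b ^ 2 + a * b + a ^ 3) ≤ C₂ * (B₄K ^ 2 + B₃' * B₄K + B₃' ^ 3) * θ ^ 2 * x ^ (5 * (K + 1 - K / m)) := by
      rw [hb', ha_eq]; exact defect_le F (B₄ := B₄K) hB₃'.le hC₂ hθ1 (K + 1 - K / m)
    -- `(B₄K² + B₃′B₄K + B₃′³)·L³·C₂ ≤ (K + 2)²·M`
    set MK : ℝ := M * ((K : ℝ) + 2) ^ 2 with hMK_def
    have hMK : 0 ≤ MK := by positivity
    have hK2 : (1 : ℝ) ≤ (K : ℝ) + 2 := by have := Nat.cast_nonneg (α := ℝ) K; linarith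
    have hK2sq : (1 : ℝ) ≤ ((K : ℝ) + 2) ^ 2 := one_le_pow₀ hK2
    have hcoef : C₂ * (B₄K ^ 2 + B₃' * B₄K + B₃' ^ 3) * (F.L : ℝ) ^ 3 ≤ MK := by
      rw [hMK_def, hM_def]
      have h1 : B₄K ^ 2 ≤ B₄ ^ 2 * ((K : ℝ) + 2) ^ 2 := by
        rw [← mul_pow]; exact pow_le_pow_left₀ hB₄K0 hB₄K2 2
      have h2 : B₃' * B₄K ≤ B₃' * B₄ * ((K : ℝ) + 2) ^ 2 := by
        calc B₃' * B₄K ≤ B₃' * (B₄ * ((K : ℝ) + 2)) := mul_le_mul_of_nonneg_left hB₄K2 hB₃'.le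
          _ = B₃' * B₄ * ((K : ℝ) + 2) := by ring
          _ ≤ B₃' * B₄ * ((K : ℝ) + 2) * ((K : ℝ) + 2) := le_mul_of_one_le_right (by positivity) hK2
          _ = B₃' * B₄ * ((K : ℝ) + 2) ^ 2 := by ring
      have h3 : B₃' ^ 3 ≤ B₃' ^ 3 * ((K : ℝ) + 2) ^ 2 := le_mul_of_one_le_right (by positivity) hK2sq
      have hsum : B₄K ^ 2 + B₃' * B₄K + B₃' ^ 3 ≤ (B₄ ^ 2 + B₃' * B₄ + B₃' ^ 3) * ((K : ℝ) + 2) ^ 2 := by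
        have hexp : (B₄ ^ 2 + B₃' * B₄ + B₃' ^ 3) * ((K : ℝ) + 2) ^ 2 =
            B₄ ^ 2 * ((K : ℝ) + 2) ^ 2 + B₃' * B₄ * ((K : ℝ) + 2) ^ 2 + B₃' ^ 3 * ((K : ℝ) + 2) ^ 2 := by ring
        rw [hexp]; linarith [h1, h2, h3]
      have hL3 : (0 : ℝ) ≤ (F.L : ℝ) ^ 3 := by positivity
      calc C₂ * (B₄K ^ 2 + B₃' * B₄K + B₃' ^ 3) * (F.L : ℝ) ^ 3
          ≤ C₂ * ((B₄ ^ 2 + B₃' * B₄ + B₃' ^ 3) * ((K : ℝ) + 2) ^ 2) * (F.L : ℝ) ^ 3 :=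
            mul_le_mul_of_nonneg_right (mul_le_mul_of_nonneg_left hsum hC₂) hL3
        _ = C₂ * (B₄ ^ 2 + B₃' * B₄ + B₃' ^ 3) * (F.L : ℝ) ^ 3 * ((K : ℝ) + 2) ^ 2 := by ring
    have hx5 : x ^ (5 * (K + 1 - K / m)) ≤ x ^ (5 * (K - K / m)) := pow_le_pow_of_le_one hx.le hx1 (by omega)
    have hdefect : C₂ * (b ^ 2 + a * b + a ^ 3) * (F.L : ℝ) ^ (3 * (F.m + (K + 1))) ≤
        MK * θ ^ 2 * x ^ (5 * (K - K / m)) * (F.L : ℝ) ^ (3 * (F.m + K)) := by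
      have h1 : C₂ * (b ^ 2 + a * b + a ^ 3) ≤ C₂ * (B₄K ^ 2 + B₃' * B₄K + B₃' ^ 3) * θ ^ 2 * x ^ (5 * (K - K / m)) :=
        hdef'.trans (mul_le_mul_of_nonneg_left hx5 (by positivity))
      rw [show (F.L : ℝ) ^ (3 * (F.m + (K + 1))) = (F.L : ℝ) ^ 3 * (F.L : ℝ) ^ (3 * (F.m + K)) by rw [← pow_add]; congr 1; ring]
      calc C₂ * (b ^ 2 + a * b + a ^ 3) * ((F.L : ℝ) ^ 3 * (F.L : ℝ) ^ (3 * (F.m + K)))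
          ≤ (C₂ * (B₄K ^ 2 + B₃' * B₄K + B₃' ^ 3) * θ ^ 2 * x ^ (5 * (K - K / m))) * ((F.L : ℝ) ^ 3 * (F.L : ℝ) ^ (3 * (F.m + K))) :=
            mul_le_mul_of_nonneg_right h1 (by positivity)
        _ = (C₂ * (B₄K ^ 2 + B₃' * B₄K + B₃' ^ 3) * (F.L : ℝ) ^ 3) * (θ ^ 2 * x ^ (5 * (K - K / m)) * (F.L : ℝ) ^ (3 * (F.m + K))) := by
            ring
        _ ≤ MK * (θ ^ 2 * x ^ (5 * (K - K / m)) * (F.L : ℝ) ^ (3 * (F.m + K))) := mul_le_mul_of_nonneg_right hcoef (by positivity)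
        _ = MK * θ ^ 2 * x ^ (5 * (K - K / m)) * (F.L : ℝ) ^ (3 * (F.m + K)) := by ring
    calc (F.scheme ℰp γ).β K * wilsonAction4 (descendTo F ℰp K (K + 1) (Nat.le_succ K) U')
        ≤ (F.scheme ℰp γ).β K * ((F.L : ℝ) * wilsonAction4 U' + C₂ * (b ^ 2 + a * b + a ^ 3) * (F.L : ℝ) ^ (3 * (F.m + (K + 1)))) :=
          mul_le_mul_of_nonneg_left hact hβ
      _ = (F.scheme ℰp γ).β (K + 1) * wilsonAction4 U' +
            (F.scheme ℰp γ).β K * (C₂ * (b ^ 2 + a * b + a ^ 3) * (F.L : ℝ) ^ (3 * (F.m + (K + 1)))) := by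
          rw [scheme_β_succ]; ring
      _ ≤ (F.scheme ℰp γ).β (K + 1) * wilsonAction4 U' +
            (F.scheme ℰp γ).β K * (MK * θ ^ 2 * x ^ (5 * (K - K / m)) * (F.L : ℝ) ^ (3 * (F.m + K))) :=
          add_le_add le_rfl (mul_le_mul_of_nonneg_left hdefect hβ)
      _ ≤ (F.scheme ℰp γ).β (K + 1) * wilsonAction4 U' + (MK * (F.L : ℝ) ^ (3 * F.m) / γ) * (Real.sqrt ((F.L : ℝ)⁻¹)) ^ K :=
          add_le_add le_rfl (beta_mul_defect_le F hm hγ hMK hθ0.le hθ1 K)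
      _ = (F.scheme ℰp γ).β (K + 1) * wilsonAction4 U' +
            (M * (F.L : ℝ) ^ (3 * F.m) / γ) * ((K : ℝ) + 2) ^ 2 * (Real.sqrt ((F.L : ℝ)⁻¹)) ^ K := by
          rw [hMK_def]; ring
  · refine ⟨1, one_pos, fun F γ hF _ _ => ?_⟩
    exact absurd (hF ▸ F.hL.2) hL

/-- **LOWER itself from the weakened schema** (`LowerAlongRegPrMinimisersAt`, through §1 at `B₃′ = max B₃ (4C₁B₄/L³)` and §2): for small `ε₀`, `m ≥ 10`,
`b₀, p₀ > 0`, small `γ`.  Log twin of `T3LowerActionSplit.lowerAlongRegPrMinimisersAt_of_split'''`.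
[cite: Balaban1985Variational, Thm 1 (8)-(10) p.279 and Prop 8 p.304] -/
theorem lowerAlongRegPrMinimisersAt_of_splitLog''' {L : ℕ} (hL : 1 ≤ L) {a₀ a₁ B₃ B₄ C₁ C₂ c C₂' c' : ℝ} (ha₀ : 0 < a₀) (ha₁ : 0 < a₁)
    (hB₃ : 0 < B₃) (hB₄ : 0 < B₄) (hC₂ : 0 < C₂) (hc : 0 < c) (hC₂' : 0 ≤ C₂') (hc' : 0 < c')
    (h8 : MinimisersIn8At L a₀ a₁ B₃) (hgrad : MinimiserCurvGradLogAt L a₀ a₁ B₃ B₄) (havg : AvgCurvGradAt L C₁ C₂ c)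
    (hdef : AvgActionDefectAt L C₂' c') :
    ∃ ε₁' : ℝ, 0 < ε₁' ∧ ∀ ε₀ : ℝ, 0 < ε₀ → ε₀ ≤ ε₁' → ∀ m : ℕ, 10 ≤ m → ∀ b₀ p₀ : ℝ, 0 < b₀ → 0 < p₀ →
      ∃ γ₁ : ℝ, 0 < γ₁ ∧ ∀ (F : T3Family) (γ : ℝ), F.L = L → 0 < γ → γ ≤ γ₁ →
        LowerAlongRegPrMinimisersAt F γ b₀ p₀ m ε₀ := by
  have hL0 : (0 : ℝ) < (L : ℝ) := by exact_mod_cast hL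
  have hL3 : (0 : ℝ) < (L : ℝ) ^ 3 := by positivity
  -- normalise `B₃` upward so that `4C₁B₄ ≤ L³B₃′`
  set B₃' : ℝ := max B₃ (4 * (C₁ * B₄) / (L : ℝ) ^ 3) with hB₃'_def
  have hBB : B₃ ≤ B₃' := le_max_left _ _
  have hB₃' : 0 < B₃' := hB₃.trans_le hBB
  have hdom : 4 * (C₁ * B₄) ≤ (L : ℝ) ^ 3 * B₃' := by
    have := le_max_right B₃ (4 * (C₁ * B₄) / (L : ℝ) ^ 3)
    rw [div_le_iff₀ hL3] at this
    linarith
  have h8' : MinimisersIn8At L a₀ a₁ B₃' := minimisersIn8At_mono le_rfl hBB h8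
  have hgrad' : MinimiserCurvGradLogAt L a₀ a₁ B₃' B₄ := minimiserCurvGradLogAt_mono le_rfl hBB hgrad
  obtain ⟨e₁, he₁, H₁⟩ := lowerAlongRegPrMinimisersAt_of_splitLog ha₀ ha₁ hB₃' hB₄.le hC₂ hc h8' hgrad' havg hdom
  have H₂ := avgActionIneqAt_of_splitLog ha₁ hB₃ hB₄ hC₂' hc' hB₃' hgrad hdef
  refine ⟨min e₁ a₀, lt_min he₁ ha₀, fun ε₀ hε₀ hle m hm b₀ p₀ hb hp => ?_⟩
  obtain ⟨γa, hγa, hA⟩ := H₁ ε₀ hε₀ (hle.trans (min_le_left _ _)) m (le_trans (by norm_num) hm) b₀ p₀ hb hp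
  obtain ⟨γb, hγb, hB⟩ := H₂ ε₀ hε₀ (hle.trans (min_le_right _ _)) m hm b₀ p₀ hb hp
  refine ⟨min γa γb, lt_min hγa hγb, fun F γ hF hγ hγle => ?_⟩
  exact hA F γ hF hγ (hγle.trans (min_le_left _ _)) (hB F γ hF hγ (hγle.trans (min_le_right _ _)))

end LowerAction

end Literature.MathematicalPhysics.QuantumFieldTheory.Balaban1983to89.T3SplitLog

end
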